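import Mathlib
import HarnessLib
import Summits.HubbardSuperconductivity.HubbardSuperconductivity.Theorems.KLProgrammeKLRegimeEngineGeneralStepResponseFitOfPosPure
import Summits.HubbardSuperconductivity.HubbardSuperconductivity.Theorems.KLProgrammePerturbedFermiCurveNumerics

/-!
# K3 gen-8-FLOW (stmt 20437, stub (C), located «(B)-MAIN-UNPRIMED», cure «(B)-MAIN-PURE»): the general-step (B) bracket booked ENTIRELY IN THE PRIMED
# (`|U|`-suppressed) column — `frameResponse_hB_flow_of_pos_pure_primed` (cell gate-hubbard-kl, seat p2 g22)

With the pure-moment door every row of the frame response of order `l ≥ 1` is `≤ X_l·U·(U²·4^{(l−2)(m+1)})` (`…ResponseFitArithPure`), and the value row is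
booked primed by the (B)-FIT anyway.  Feeding `…OfPosPure.frameResponse_hB_flow_of_pos_pure` the table `μc := (X 0, U·X 1, …, U·X 4)` and using the
linearity of k3c3-p3's reading-jet tables `readJetC`, `readJetC′` in `μc`, the output pair `(eB, eB′) = ((0, readJetC μc ·), (μc 0, readJetC′ R μc ·))` is
dominated by the PRIMED-ONLY pair `(0, (X 0, readJetC X k + readJetC′ R X k))` — the same booking as the (C2) transport fit `transport_jets_flow_fit`
(`eT = 0`).  So the (B) bracket puts NOTHING in the unprimed curve-jet column `klC4aJetC2`; the closer's (B) share is read against `klC4aJetC′ P R` only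
(KL STATUS 2026-08-28, pen (R239) condition (i) becomes void for this booking).

* `readJetC_scale`, `readJetC'_scale` — `readJetC (l ↦ [l = 0] a + [l ≠ 0] U·X l) k = U·readJetC X k`, same for `readJetC′`;
* `readJetC_nonneg_of_nonneg`, `readJetC'_nonneg_of_nonneg` — signs (`klCurveD_sizes_nonneg`, `klCurveB3/B4/G4_nonneg`, `Gfr ≥ 0`);
* `curveJetBar_scaled_le_primed` — the domination of the bars;
* **`frameResponse_hB_flow_of_pos_pure_primed`** — hypotheses of `…_of_pos_pure` with the budget word replaced by a table `X ≥ 0` with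
  `X-expression_l ≤ X l` (`l ≤ 4`); output `ContDiff … ∧ ∀ k ≤ 4, |∂ᵏ(B)| ≤ curveJetBar (fun _ => 0) (fun k => if k = 0 then X 0 else readJetC X k + readJetC′ R X k) U k (m+1)`.

Composition + table algebra only; no definitions; nothing asserts any stub of 20437, K3, the margin or superconductivity.
References: BGM 2006 §2.4 Lemma 2.1 (2.36)–(2.42) [cite: BenfattoGiulianiMastropietro2006].
-/

noncomputable section

namespace Summit.HubbardSuperconductivity.HubbardSuperconductivity.Theorems.EngineV8

set_option linter.dupNamespace false -- summit = problem name (single-conjunct summit), D-0017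
set_option exponentiation.threshold 1024 -- `2^200` literal in the budget expressions

open Complex Real Finset Filter Literature.MathematicalPhysics.QuantumLattice Literature.Probability.LatticeModels GrassmannAlgebra
open Literature.MathematicalPhysics.QuantumLattice.BandSectorCounting
open Summit.HubbardSuperconductivity.HubbardSuperconductivity.Theorems.KLRegimeSplit
open Summit.HubbardSuperconductivity.HubbardSuperconductivity.Theorems.DispersionFlow
open Summit.HubbardSuperconductivity.HubbardSuperconductivity.Theorems.KLProgrammeLegKernels
open Summit.HubbardSuperconductivity.HubbardSuperconductivity.Theorems.PerturbedFermiCurve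
open scoped Nat

/-! ## §1 Table algebra -/

/-- **`readJetC` is linear in `μc 1…4` and blind to `μc 0`**: `readJetC (l ↦ if l = 0 then a else U·X l) k = U·readJetC X k`.
[cite: BenfattoGiulianiMastropietro2006, §2.4 (2.40)] -/
theorem readJetC_scale (a U : ℝ) (X : ℕ → ℝ) (k : ℕ) :
    readJetC (fun l => if l = 0 then a else U * X l) k = U * readJetC X k := by
  simp only [readJetC, Nat.one_ne_zero, if_false, show (2:ℕ) ≠ 0 from by norm_num, show (3:ℕ) ≠ 0 from by norm_num, show (4:ℕ) ≠ 0 from by norm_num]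
  split_ifs <;> ring

/-- **`readJetC′ R` is linear in `μc 1, μc 2` and blind to `μc 0`**: `readJetC′ R (l ↦ if l = 0 then a else U·X l) k = U·readJetC′ R X k`.
[cite: BenfattoGiulianiMastropietro2006, §2.4 (2.40)] -/
theorem readJetC'_scale (R : RenConsts) (a U : ℝ) (X : ℕ → ℝ) (k : ℕ) :
    readJetC' R (fun l => if l = 0 then a else U * X l) k = U * readJetC' R X k := by
  simp only [readJetC', Nat.one_ne_zero, if_false, show (2:ℕ) ≠ 0 from by norm_num]
  split_ifs <;> ring

/-- `0 ≤ readJetC X k` for `X ≥ 0` (curve sizes `D1, D2, D3(0), D4(0,0) ≥ 0`). [cite: BenfattoGiulianiMastropietro2006, §2.4 (2.40)] -/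
theorem readJetC_nonneg_of_nonneg {X : ℕ → ℝ} (hX : ∀ l, 0 ≤ X l) (k : ℕ) : 0 ≤ readJetC X k := by
  obtain ⟨h1, h2, h3, h4⟩ := klCurveD_sizes_nonneg (le_refl (0 : ℝ)) (le_refl (0 : ℝ))
  have := hX 1; have := hX 2; have := hX 3; have := hX 4
  simp only [readJetC]
  split_ifs <;> positivity

/-- `0 ≤ readJetC′ R X k` for `X ≥ 0`, `Gfr ≥ 0` (`B3, B4, G4 ≥ 0`). [cite: BenfattoGiulianiMastropietro2006, §2.4 (2.40)] -/
theorem readJetC'_nonneg_of_nonneg {R : RenConsts} (hR : ∀ j, 0 ≤ R.Gfr j) {X : ℕ → ℝ} (hX : ∀ l, 0 ≤ X l) (k : ℕ) : 0 ≤ readJetC' R X k := by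
  obtain ⟨h1, -, -, -⟩ := klCurveD_sizes_nonneg (le_refl (0 : ℝ)) (le_refl (0 : ℝ))
  have := klCurveB3_nonneg; have := klCurveB4_nonneg; have := klCurveG4_nonneg
  have := hX 1; have := hX 2; have := hR 3; have := hR 4
  simp only [readJetC']
  split_ifs <;> positivity

/-- **The scaled (B) bars are dominated by the primed-only bars**: for `0 ≤ U ≤ 1`, `X ≥ 0`, `Gfr ≥ 0`, with `μc := (X 0, U·X 1, …)`,
`curveJetBar (0, readJetC μc ·) (μc 0, readJetC′ R μc ·) U k n ≤ curveJetBar 0 (X 0, readJetC X · + readJetC′ R X ·) U k n`.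
[cite: BenfattoGiulianiMastropietro2006, §2.4 (2.40)] -/
theorem curveJetBar_scaled_le_primed {R : RenConsts} (hR : ∀ j, 0 ≤ R.Gfr j) {U : ℝ} (hU : 0 ≤ U) (hU1 : U ≤ 1) {X : ℕ → ℝ} (hX : ∀ l, 0 ≤ X l)
    (k n : ℕ) :
    curveJetBar (fun k => if k = 0 then 0 else readJetC (fun l => if l = 0 then X 0 else U * X l) k)
        (fun k => if k = 0 then (fun l : ℕ => if l = 0 then X 0 else U * X l) 0 else readJetC' R (fun l => if l = 0 then X 0 else U * X l) k) U k n ≤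
      curveJetBar (fun _ => 0) (fun k => if k = 0 then X 0 else readJetC X k + readJetC' R X k) U k n := by
  rw [curveJetBar_apply, curveJetBar_apply]
  have hz : 0 ≤ uPow k U * (4 : ℝ) ^ (((k : ℤ) - 2) * n) := mul_nonneg (uPow_nonneg k U) (zpow_nonneg (by norm_num) _)
  rw [mul_assoc, mul_assoc]
  refine mul_le_mul_of_nonneg_right ?_ hz
  rcases Nat.eq_zero_or_pos k with rfl | hk
  · simp
  · have hk' : k ≠ 0 := by omega
    simp only [hk', if_false, readJetC_scale, readJetC'_scale, zero_add]
    have h1 := readJetC_nonneg_of_nonneg hX k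
    have h2 := readJetC'_nonneg_of_nonneg hR hX k
    rw [abs_of_nonneg hU]
    nlinarith [mul_nonneg h2 hU, mul_nonneg h1 hU]

/-! ## §2 The one call, primed booking -/

section GeneralOfPosPurePrimed

variable {L M : ℕ} [NeZero L] [NeZero M]

/-- **«(B)-FIT» AT THE GENERAL STEP, PURE-MOMENT DOOR, BOOKED ENTIRELY PRIMED** — see the module docstring.
[cite: BenfattoGiulianiMastropietro2006, §2.4 Lemma 2.1 (2.36)–(2.42)] -/
theorem frameResponse_hB_flow_of_pos_pure_primed {R : RenConsts} (hR : ∀ j, 0 ≤ R.Gfr j) {c : ℝ} (hc : 0 < c) (hcle : c ≤ klCurveC3 R)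
    {U : ℝ} (hU : 0 < U) (hU1 : U ≤ 1) (hUle : U ≤ klCurveU0 R) {β : ℝ} (hβmin : klBetaMin ≤ β) (hβc : β ≤ Real.exp (c / U ^ 2))
    {μ : ℝ} (hμ : μ ∈ klWindowC) (m : ℕ) (hm1 : m + 1 ≤ nScales β)
    {G : GeoConsts} {Q : EngConsts} (hGS : ∀ k, 0 ≤ G.S k) (hQS : ∀ k, 0 ≤ Q.S' k)
    {Nf₁ N : ℕ} (hOK₁ : FrameOK R U Nf₁ μ (klFlowFrameU L M β U μ m)) (hOK₂ : FrameOK R U N μ (klFlowFrameU L M β U μ (m + 1))) (hNn : N ≤ m + 1)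
    (hZ₂ : IsUnit (effPartitionFn ℂ (normalCovariance L M (uvSymbolCT L M β μ (klFlowFrameU L M β U μ (m + 1)) (klScale klE0 m))) (hubbardInteraction L M β U + counterQuadratic L M β (klFlowFrameU L M β U μ (m + 1)))))
    (hZ : ∀ t ∈ Set.Icc (0 : ℝ) 1, effPartitionFn ℂ
      (normalCovariance L M (uvSymbolCT L M β μ (klFlowFrameU L M β U μ m) (klScale klE0 m)) + ((t : ℂ)) • (normalCovariance L M (fun ks => uvSymbolCT L M β μ (klFlowFrameU L M β U μ (m + 1)) (klScale klE0 m) ks / (1 + uvSymbolCT L M β μ (klFlowFrameU L M β U μ (m + 1)) (klScale klE0 m) ks * (((fsub (klFlowFrameU L M β U μ (m + 1)) (klFlowFrameU L M β U μ m)).eval (latticeMomentum L ks.1.2) / (β * (L : ℝ) ^ 2) : ℝ) : ℂ))) - normalCovariance L M (uvSymbolCT L M β μ (klFlowFrameU L M β U μ m) (klScale klE0 m)))) (hubbardInteraction L M β U + counterQuadratic L M β (klFlowFrameU L M β U μ m)) ≠ 0)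
    -- the flow history and the closed envelopes (verbatim from the door)
    {n : ℕ} (hP : ∀ m' ≤ n, FlowPieceJetsAt L M β U μ R m') (hTJ : ∀ m' ≤ n, TwoLegReadJetsF L M G Q β U μ m') (hmn : m ≤ n)
    (hR0 : 0 < R.Gfr 0) {W Ξ Θ : ℝ} (hW : W = curveExtC (8 * 576 * (342 : ℝ) ^ 4) G.S 1 + curveExtC (8 * 576 * (342 : ℝ) ^ 4) Q.S' 1 * |U|)
    (hΞ : Ξ = (2 ^ 10 * (1 + Real.pi ^ 8 * (W * U ^ 2) / 2 ^ 11) + ∑ j ∈ range 5, R.Gfr j))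
    (hΘ : Θ = (1 + ((∑ j ∈ range 5, R.Gfr j) + Real.pi ^ 8 * W / 2 ^ 11) * |U| / R.Gfr 0))
    (hdoor : R.Gfr 0 * |U| + ((∑ j ∈ range 5, R.Gfr j) + Real.pi ^ 8 * W / 2 ^ 11) * U ^ 2 ≤ 1 / 128) {P : SplitConsts} (hL : klEngL₄ P R β U ≤ L)
    {s : ℕ} (hs : 30 ≤ s)
    -- E1: β-free graded constant families (four-leg: PURE weight, `U²` law at orders ≥ 1)
    {cN cS cE : ℕ → ℝ} {cSs cEs : ℝ} (hcN : ∀ l, 0 ≤ cN l) (hcS : ∀ l, 0 ≤ cS l) (hcE : ∀ l, 0 ≤ cE l) (hcSs : 0 ≤ cSs) (hcEs : 0 ≤ cEs)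
    (hNp0 : ∀ t ∈ Set.Icc (0 : ℝ) 1, ∀ (σ : Fin 2) (A : HubbardFieldIdx L M) (x₀ : SpaceTimeIdx L M), imagTimeWeight β M ^ 3 *
      ∑ x ∈ (univ : Finset (Fin 4 → SpaceTimeIdx L M)).filter (fun x => x 0 = x₀),
        (((((x 1).2 - (x 0).2) 0).valMinAbs.natAbs : ℝ) + ((((x 1).2 - (x 0).2) 1).valMinAbs.natAbs : ℝ)) ^ 0 *
          ‖sectorisedKernel L M β (trivialMultiplier L M)
            (effAction ℂ (normalCovariance L M (uvSymbolCT L M β μ (klFlowFrameU L M β U μ m) (klScale klE0 m)) + ((t : ℂ)) • (normalCovariance L M (fun ks => uvSymbolCT L M β μ (klFlowFrameU L M β U μ (m + 1)) (klScale klE0 m) ks / (1 + uvSymbolCT L M β μ (klFlowFrameU L M β U μ (m + 1)) (klScale klE0 m) ks * (((fsub (klFlowFrameU L M β U μ (m + 1)) (klFlowFrameU L M β U μ m)).eval (latticeMomentum L ks.1.2) / (β * (L : ℝ) ^ 2) : ℝ) : ℂ))) - normalCovariance L M (uvSymbolCT L M β μ (klFlowFrameU L M β U μ m) (klScale klE0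 m)))) (hubbardInteraction L M β U + counterQuadratic L M β (klFlowFrameU L M β U μ m))) 4
            (![((0, σ), 0), ((0, σ), 1), ((0, A.1.2), 1 - A.2), ((0, A.1.2), A.2)] : Fin 4 → SectorLeg 1) x‖ ≤ cN 0 * U)
    (hNp : ∀ l, 1 ≤ l → l ≤ 4 → ∀ t ∈ Set.Icc (0 : ℝ) 1, ∀ (σ : Fin 2) (A : HubbardFieldIdx L M) (x₀ : SpaceTimeIdx L M), imagTimeWeight β M ^ 3 *
      ∑ x ∈ (univ : Finset (Fin 4 → SpaceTimeIdx L M)).filter (fun x => x 0 = x₀),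
        (((((x 1).2 - (x 0).2) 0).valMinAbs.natAbs : ℝ) + ((((x 1).2 - (x 0).2) 1).valMinAbs.natAbs : ℝ)) ^ l *
          ‖sectorisedKernel L M β (trivialMultiplier L M)
            (effAction ℂ (normalCovariance L M (uvSymbolCT L M β μ (klFlowFrameU L M β U μ m) (klScale klE0 m)) + ((t : ℂ)) • (normalCovariance L M (fun ks => uvSymbolCT L M β μ (klFlowFrameU L M β U μ (m + 1)) (klScale klE0 m) ks / (1 + uvSymbolCT L M β μ (klFlowFrameU L M β U μ (m + 1)) (klScale klE0 m) ks * (((fsub (klFlowFrameU L M β U μ (m + 1)) (klFlowFrameU L M β U μ m)).eval (latticeMomentum L ks.1.2) / (β * (L : ℝ) ^ 2) : ℝ) : ℂ))) - normalCovariance L M (uvSymbolCT L M β μ (klFlowFrameU L M β U μ m) (klScale klE0 m)))) (hubbardInteraction L M β U + counterQuadratic L M β (klFlowFrameU L M β U μ m))) 4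
            (![((0, σ), 0), ((0, σ), 1), ((0, A.1.2), 1 - A.2), ((0, A.1.2), A.2)] : Fin 4 → SectorLeg 1) x‖ ≤ cN l * U ^ 2 * ((4 : ℝ) ^ m) ^ l)
    (hSp : ∀ l ≤ 4, ∀ t ∈ Set.Icc (0 : ℝ) 1, ∀ (σ : Fin 2) (x₀ : SpaceTimeIdx L M),
      (imagTimeWeight β M * ∑ x ∈ (univ : Finset (Fin 2 → SpaceTimeIdx L M)).filter (fun x => x 0 = x₀),
        (1 + ((((x 1).2 - (x 0).2) 0).valMinAbs.natAbs : ℝ) + ((((x 1).2 - (x 0).2) 1).valMinAbs.natAbs : ℝ)) ^ l *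
          ‖sectorisedKernel L M β (trivialMultiplier L M)
            (effAction ℂ (normalCovariance L M (uvSymbolCT L M β μ (klFlowFrameU L M β U μ m) (klScale klE0 m)) + ((t : ℂ)) • (normalCovariance L M (fun ks => uvSymbolCT L M β μ (klFlowFrameU L M β U μ (m + 1)) (klScale klE0 m) ks / (1 + uvSymbolCT L M β μ (klFlowFrameU L M β U μ (m + 1)) (klScale klE0 m) ks * (((fsub (klFlowFrameU L M β U μ (m + 1)) (klFlowFrameU L M β U μ m)).eval (latticeMomentum L ks.1.2) / (β * (L : ℝ) ^ 2) : ℝ) : ℂ))) - normalCovariance L M (uvSymbolCT L M β μ (klFlowFrameU L M β U μ m) (klScale klE0 m)))) (hubbardInteraction L M β U + counterQuadratic L M β (klFlowFrameU L M β U μ m))) 2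
            (![((0, σ), 0), ((0, σ), 1)] : Fin 2 → SectorLeg 1) x‖ ≤ cS l * U * ((4 : ℝ) ^ m) ^ l))
    (hSps : ∀ t ∈ Set.Icc (0 : ℝ) 1, ∀ (σ : Fin 2) (x₀ : SpaceTimeIdx L M),
      (imagTimeWeight β M * ∑ x ∈ (univ : Finset (Fin 2 → SpaceTimeIdx L M)).filter (fun x => x 0 = x₀),
        (1 + ((((x 1).2 - (x 0).2) 0).valMinAbs.natAbs : ℝ) + ((((x 1).2 - (x 0).2) 1).valMinAbs.natAbs : ℝ)) ^ s *
          ‖sectorisedKernel L M β (trivialMultiplier L M)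
            (effAction ℂ (normalCovariance L M (uvSymbolCT L M β μ (klFlowFrameU L M β U μ m) (klScale klE0 m)) + ((t : ℂ)) • (normalCovariance L M (fun ks => uvSymbolCT L M β μ (klFlowFrameU L M β U μ (m + 1)) (klScale klE0 m) ks / (1 + uvSymbolCT L M β μ (klFlowFrameU L M β U μ (m + 1)) (klScale klE0 m) ks * (((fsub (klFlowFrameU L M β U μ (m + 1)) (klFlowFrameU L M β U μ m)).eval (latticeMomentum L ks.1.2) / (β * (L : ℝ) ^ 2) : ℝ) : ℂ))) - normalCovariance L M (uvSymbolCT L M β μ (klFlowFrameU L M β U μ m) (klScale klE0 m)))) (hubbardInteraction L M β U + counterQuadratic L M β (klFlowFrameU L M β U μ m))) 2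
            (![((0, σ), 0), ((0, σ), 1)] : Fin 2 → SectorLeg 1) x‖ ≤ cSs * U * ((4 : ℝ) ^ m) ^ s))
    (hSEp : ∀ l ≤ 4, ∀ (σ : Fin 2) (x₀ : SpaceTimeIdx L M),
      (imagTimeWeight β M * ∑ x ∈ (univ : Finset (Fin 2 → SpaceTimeIdx L M)).filter (fun x => x 0 = x₀),
        (1 + ((((x 1).2 - (x 0).2) 0).valMinAbs.natAbs : ℝ) + ((((x 1).2 - (x 0).2) 1).valMinAbs.natAbs : ℝ)) ^ l *
          ‖sectorisedKernel L M β (trivialMultiplier L M)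
            (effAction ℂ (normalCovariance L M (fun ks => uvSymbolCT L M β μ (klFlowFrameU L M β U μ (m + 1)) (klScale klE0 m) ks / (1 + uvSymbolCT L M β μ (klFlowFrameU L M β U μ (m + 1)) (klScale klE0 m) ks * (((fsub (klFlowFrameU L M β U μ (m + 1)) (klFlowFrameU L M β U μ m)).eval (latticeMomentum L ks.1.2) / (β * (L : ℝ) ^ 2) : ℝ) : ℂ)))) (hubbardInteraction L M β U + counterQuadratic L M β (klFlowFrameU L M β U μ m))) 2
            (![((0, σ), 0), ((0, σ), 1)] : Fin 2 → SectorLeg 1) x‖ ≤ cE l * U * ((4 : ℝ) ^ m) ^ l))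
    (hSEs : ∀ (σ : Fin 2) (x₀ : SpaceTimeIdx L M),
      (imagTimeWeight β M * ∑ x ∈ (univ : Finset (Fin 2 → SpaceTimeIdx L M)).filter (fun x => x 0 = x₀),
        (1 + ((((x 1).2 - (x 0).2) 0).valMinAbs.natAbs : ℝ) + ((((x 1).2 - (x 0).2) 1).valMinAbs.natAbs : ℝ)) ^ s *
          ‖sectorisedKernel L M β (trivialMultiplier L M)
            (effAction ℂ (normalCovariance L M (fun ks => uvSymbolCT L M β μ (klFlowFrameU L M β U μ (m + 1)) (klScale klE0 m) ks / (1 + uvSymbolCT L M β μ (klFlowFrameU L M β U μ (m + 1)) (klScale klE0 m) ks * (((fsub (klFlowFrameU L M β U μ (m + 1)) (klFlowFrameU L M β U μ m)).eval (latticeMomentum L ks.1.2) / (β * (L : ℝ) ^ 2) : ℝ) : ℂ)))) (hubbardInteraction L M β U + counterQuadratic L M β (klFlowFrameU L M β U μ m))) 2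
            (![((0, σ), 0), ((0, σ), 1)] : Fin 2 → SectorLeg 1) x‖ ≤ cEs * U * ((4 : ℝ) ^ m) ^ s))
    -- the (B) budget word as a primed table
    {X : ℕ → ℝ} (hX0 : ∀ l, 0 ≤ X l)
    (hXv : 2 ^ 32 / 4 ^ 0 * R.Gfr 0 * cN 0 + (klEngRsq R ^ 4 * (cS 0 ^ 2 + cE 0 + 1) + (cSs ^ 2 + cEs + 1)) / 2 ^ 200 ≤ X 0)
    (hX : ∀ l, 1 ≤ l → l ≤ 4 → 2 ^ 32 / 4 ^ l * R.Gfr 0 * cN l + (klEngRsq R ^ 4 * (cS l ^ 2 + cE l + 1) + (cSs ^ 2 + cEs + 1)) / 2 ^ 200 ≤ X l) :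
    ContDiff ℝ 4 (fun θ : ℝ =>
      (symInterp L (fun k => klLocSelfEnergyRe L M β U μ (klFlowFrameU L M β U μ (m + 1)) m k -
            (klFlowFrameU L M β U μ (m + 1)).eval (latticeMomentum L k))).eval (klFermiPoint μ (klFlowFrameU L M β U μ (m + 1)) θ) -
        (symInterp L (fun k => klLocSelfEnergyRe L M β U μ (klFlowFrameU L M β U μ m) m k -
            (klFlowFrameU L M β U μ m).eval (latticeMomentum L k))).eval (klFermiPoint μ (klFlowFrameU L M β U μ (m + 1)) θ)) ∧
    ∀ k ≤ 4, ∀ θ : ℝ, |iteratedDeriv k (fun θ : ℝ =>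
      (symInterp L (fun k => klLocSelfEnergyRe L M β U μ (klFlowFrameU L M β U μ (m + 1)) m k -
            (klFlowFrameU L M β U μ (m + 1)).eval (latticeMomentum L k))).eval (klFermiPoint μ (klFlowFrameU L M β U μ (m + 1)) θ) -
        (symInterp L (fun k => klLocSelfEnergyRe L M β U μ (klFlowFrameU L M β U μ m) m k -
            (klFlowFrameU L M β U μ m).eval (latticeMomentum L k))).eval (klFermiPoint μ (klFlowFrameU L M β U μ (m + 1)) θ)) θ| ≤
      curveJetBar (fun _ => 0) (fun k => if k = 0 then X 0 else readJetC X k + readJetC' R X k) U k (m + 1) := by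
  have hμc0 : ∀ l, 0 ≤ (fun l : ℕ => if l = 0 then X 0 else U * X l) l := fun l => by
    by_cases hl : l = 0
    · simp only [hl, if_true]; exact hX0 0
    · simp only [hl, if_false]; exact mul_nonneg hU.le (hX0 l)
  have hμcv' : 2 ^ 32 / 4 ^ 0 * R.Gfr 0 * cN 0 + (klEngRsq R ^ 4 * (cS 0 ^ 2 + cE 0 + 1) + (cSs ^ 2 + cEs + 1)) / 2 ^ 200 ≤ (fun l : ℕ => if l = 0 then X 0 else U * X l) 0 := by
    simp only [if_true]; exact hXv
  have hμc' : ∀ l, 1 ≤ l → l ≤ 4 →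
      U * (2 ^ 32 / 4 ^ l * R.Gfr 0 * cN l + (klEngRsq R ^ 4 * (cS l ^ 2 + cE l + 1) + (cSs ^ 2 + cEs + 1)) / 2 ^ 200) ≤
        (fun l : ℕ => if l = 0 then X 0 else U * X l) l := fun l hl1 hl4 => by
    simp only [show l ≠ 0 by omega, if_false]
    exact mul_le_mul_of_nonneg_left (hX l hl1 hl4) hU.le
  obtain ⟨hd, hB⟩ := frameResponse_hB_flow_of_pos_pure hR hc hcle hU hU1 hUle hβmin hβc hμ m hm1 hGS hQS hOK₁ hOK₂ hNn hZ₂ hZ hP hTJ hmn hR0 hW hΞ hΘ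
    hdoor hL hs hcN hcS hcE hcSs hcEs hNp0 hNp hSp hSps hSEp hSEs (μc := fun l : ℕ => if l = 0 then X 0 else U * X l) hμc0 hμcv' hμc'
  exact ⟨hd, fun k hk θ => (hB k hk θ).trans (curveJetBar_scaled_le_primed hR hU.le hU1 hX0 k (m + 1))⟩

end GeneralOfPosPurePrimed

end Summit.HubbardSuperconductivity.HubbardSuperconductivity.Theorems.EngineV8

end
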